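import Summits.QuantumFields.YangMills.Theorems.BalabanUVNodesN07QOfRecordInfGauge
import Summits.QuantumFields.YangMills.Theorems.BalabanUVNodesN07LaplaceAOfRecordGaugeOrbitPos
import Literature.MathematicalPhysics.QuantumFieldTheory.Balaban1983to89.B9Eq3119InvariantExtension
import Literature.MathematicalPhysics.QuantumFieldTheory.Balaban1983to89.B5Eq172PoincareTorus
import HarnessLib

/-!
# NODE N07 — PRINT'S `π_{U₀} = 1 − D_{U₀} G′ R D*_{U₀}` AT THE RECORD, CONSTRUCTED AT EVERY BACKGROUND: THE SCALAR OPERATOR `Δ′(U₀) = Δ_{U₀} + Π` ON THE GAUGE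
# PARAMETERS IS POSITIVE DEFINITE WHENEVER `Π ≥ 0` PINS THE `k`-BLOCK CENTRES (a covariantly constant site function vanishing at one site vanishes), SO `G′ := (Δ′)⁻¹`
# EXISTS (lit `greenK`), (g5) HOLDS, AND — WITH ✓p818947's (g2) — [B9] (3.124) `Q G̃₁ D R = 0` FOR EVERY `π`-SANDWICHED HESSIAN SLOT `π†Δπ` AT EVERY GUARDED `U₀`

Cell `pub-ymgap`, width seat `pub-ymgap-dag-n07-w3` (g25), INTENT-4 ∕ CLAIM-4.  `--kind proof --supports stmt-QuantumFields-27238 --as helper`; count-neutral.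
[B9] = [Balaban1985BackgroundPropagators]; [15] = [Balaban1985Variational]; [B5] = [Balaban1984PropagatorsI].

WHY.  def-Y's M2 fork (v2-d′) for the `𝒢`-slot at a general guarded background is pin (b): the (3.119)∕(3.122) Hessian `Δ_π = π†Δπ` with print's projection
`π = 1 − D G′ R D*` ([B9] p. 419), `G′ = (Δ′_a)⁻¹` the Green's function of the SCALAR operator (3.24)–(3.25) on the gauge parameters.  RR-2 g29's CHECK-Δ word (R-Δ3) lists what
such a pin displays: `hposπ` ([B9] Thm 3.11∕3.12 — an estimate), `Gp`'s `hpos′`, (g2), (g5).  Of these, (g5) is lit ✓`printGreen_gaugeMode` once `Gp := greenK T′ hpos′`; (g2) at a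
general guarded `U₀` is this seat's ✓p818947; and `hpos′` — mere POSITIVITY of `Δ′` (not its spectral gap) — is ELEMENTARY AT EVERY BACKGROUND: `re⟪λ, Δ_{U₀}λ⟫ = ‖D_{U₀}λ‖²`, and a
covariantly constant `λ` (`D_{U₀}λ = 0`: `λ(b₊) = Ad_{U₀(b)}⁻¹λ(b₋)`, an isometry bond by bond) has CONSTANT FIBRE NORM on the connected torus ([B5] p. 22 «constant functions form the
eigenspace corresponding to the eigenvalue 0», transported), so it vanishes as soon as it vanishes at one site — e.g. at a `k`-block centre, which `Q′♭λ = 0` (def-Y's ✓`QflatOfRecord`)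
provides.  This file proves that, packages print's `G′` and `π` at the record for ANY centre-pinning `Π` (one concrete `Π` — `a` times the orthogonal projection onto `N(Q′♭)ᗮ` — is
exhibited), and assembles [B9] (3.124) for every `π`-sandwiched Hessian slot from lit ✓`h124_of_printExtension` + ✓p818947 — so that a (b)-pin's only displayed letter left is `hposπ`.

WHAT IS PROVED (sorry-free; no definition; axioms standard).
* §1 `RRec_eq_AdW`, `inner_RRec_RRec` ∕ `norm_RRec` (the record's transporters are fibre isometries), `covDerivL2K_apply_eq_zero_iff` (`D_{U₀}λ = 0` bondwise: `Ad λ(b₊) = λ(b₋)`).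
* §2 ★★ `norm_apply_const_of_covDerivL2K_eq_zero` (a covariantly constant site function has constant fibre norm — `TorusChart.d₀_eq_zero_iff` on `z ↦ ‖λ(z)‖`),
  ★★ `eq_zero_of_covDerivL2K_eq_zero_of_apply_eq_zero` (… and vanishes if it vanishes at one site), ★★★ `eq_zero_of_covDerivL2K_eq_zero_of_QflatOfRecord_eq_zero`
  (`D_{U₀}λ = 0 → Q′♭λ = 0 → λ = 0`, EVERY `U₀`).
* §3 `re_inner_covLaplaceSiteOfRecord` (`re⟪λ, Δ_{U₀}λ⟫ = ‖D_{U₀}λ‖²`), ★★★ `covLaplaceSiteOfRecord_add_pos` — for EVERY `Π` with `0 ≤ re⟪λ, Πλ⟫` and `re⟪λ, Πλ⟫ = 0 → Q′♭λ = 0`: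
  `λ ≠ 0 → 0 < re⟪λ, (Δ_{U₀} + Π)λ⟫` (**`hpos′` AT EVERY BACKGROUND**); ★ `covLaplaceSiteOfRecord_add_kerProj_pos` (the concrete `Π := a • proj_{N(Q′♭)ᗮ}`, `a > 0`) and
  `kerProj_apply_eq_zero_of_QflatOfRecord_eq_zero` (it kills `N(Q′♭)`, so `Δ′ = Δ_{U₀}` there: the `hT′` of lit's `printGreen_gaugeMode`).
* §4 (print's `G′` and `π` at the record, `T′` ANY operator agreeing with `Δ_{U₀}` on `N(Q′♭)` with `hpos′`): ★★ `printGreen_gaugeMode_ofRecord` ((g5): `Q′♭λ = 0 → G′(Δ_{U₀}λ) = λ`),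
  ★★ `printProjectionOfRecord_gaugeMode` (`π (D_{U₀}λ) = 0` for `Q′♭λ = 0`, `R := RrOfRecord F N k U₀ Q′♭`).
* §5 ★★★ `Q_G1_covDeriv_Rr_ofRecord_pi` — **[B9] (3.124) `Q G̃₁ D R = 0` AT EVERY GUARDED BACKGROUND** for the Hessian slot `π†Δπ` (ANY `Δ`), `Q := QOfRecord F N k U₀`, `Q′ := QflatOfRecord F N k`,
  modulo only the displayed `hposπ`; ★★ `Rr_covDiv_G1_covDeriv_Rr_ofRecord_pi` (`R D* G̃₁ D R = R`, p. 425); ★★ `Rr_covDiv_G1_adjointQ_ofRecord_pi` (`R D* G̃₁ Q* = 0` for symmetric `Δ`).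

HONEST SCOPE.  Positivity (qualitative) only — NO spectral gap, no constant, nothing of [B9] Thms 3.1–3.13 (the uniform lower bounds ∕ decay are the node's estimates and stay
displayed: `hposπ`); the Hessian slot `Δ` and the pinning term `Π`∕`T′` are PARAMETERS (def-Y pins them; nothing of theirs is re-declared); the guard `SmallBelow (avOfRecord F N K) k U₀` of
(g2) is displayed; P0 ⟨26900⟩ OPEN; K0ᴬ∕K1ᴬ∕K3ᴬ OPEN; N07 NOT discharged; COUNT 8∕28 · K 1∕4 UNMOVED; finite `𝕋⁴` at fixed `ε` — R4 closes only the conditional finite-𝕋⁴ rung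
`BalabanLadder.UV`, never the summit; nothing continuum ∕ ℝ⁴ ∕ OS; the Yang–Mills mass gap (Clay) is NOT proved by any of this.  No `sorry`, no `def`, no `instance`, no `notation`.

References: [B9] (3.3) p. 391, (3.8)–(3.10) p. 392, (3.21)–(3.25) p. 394, (3.115)–(3.119) pp. 418–419, (3.122)–(3.124) p. 420, p. 425; [15] (102) p. 293, (110)–(111) p. 294; [B5] p. 22, (1.72) p. 30.
-/

set_option autoImplicit false

noncomputable section

open scoped InnerProductSpace ComplexConjugate Matrix

namespace Summit.QuantumFields.YangMills.Theorems.N07PrintProjectionOfRecord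

open Literature.MathematicalPhysics.QuantumFieldTheory (TorusChart)
open Literature.MathematicalPhysics.QuantumFieldTheory.Balaban1983to89
open Literature.MathematicalPhysics.QuantumFieldTheory.Balaban1983to89.T4Continuum (T4Family)
open T4Continuum BlockAveraging B15DeterminingSets
open B4Sect5Torus (TSite)
open B9SectCLatticeCarrier (Bond bpos btgt shift)
open B9Eq311L2Pairing (WL2)
open B11Eq103H1Complex (SiteL2K BondL2K covDerivL2K covDivL2K covLaplaceSiteK RLatticeK G1LatticeK laplaceALatticeK greenK greenK_apply equiv_covDerivL2K
  inner_covDivL2K_covDerivL2K)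
open B9Eq33CovDerivVector (covDeriv_apply)
open B9Eq328GaugeAction (AdW adTransportW_eq_AdW)
open B9Eq3119InvariantExtension (printGreen_gaugeMode printProjectionLattice_gaugeMode_greenK h124_of_printExtension hRDR_of_invariantExtension h124'_of_invariantExtension
  invariantExtension_isSymmetric printProjectionLattice_gaugeMode)
open B5Eq172PoincareTorus (chartT shift_eq_add_gen)
open Node00
open Summit.QuantumFields.YangMills.Theorems.N07LaplaceAOfRecordGaugeOrbitPos (inner_AdW_suToUnits)
open Summit.QuantumFields.YangMills.Theorems.N07QOfRecordInfGauge (QOfRecord_covDerivL2K_eq_zero_of_QflatOfRecord_eq_zero)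

variable (F : T4Family) (N : ℕ) {K : ℕ} (k : ℕ) (U₀ : GaugeField (F.P K) 0 (SU N))

/-! ## §1  The record's transporters are fibre isometries; `D_{U₀}λ = 0` bondwise -/

omit k in
/-- `R(U₀(a))` of record IS `Ad` of the unit `suToUnits (U₀ (bondToLit⁻¹ a))` on the fibre. [cite: Balaban1985BackgroundPropagators, p.390] -/
theorem RRec_eq_AdW (a : Bond (F.P K).d (fun _ => (F.P K).sitesPerDir 0)) :
    RRec F N U₀ a = AdW (phiRec N) (suToUnits N (U₀ ((bondToLit (F.P K) 0).symm a))) := by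
  unfold RRec
  rw [adTransportW_eq_AdW]
  rfl

omit k in
/-- **THE TRANSPORTERS ARE ISOMETRIES OF THE FIBRE**: `⟪R(U₀(a))v, R(U₀(a))w⟫ = ⟪v, w⟫` (`SU(N)` unitary, `⟨X, Y⟩ = tr X*Y`). [cite: Balaban1985BackgroundPropagators, (3.31) p.395] -/
theorem inner_RRec_RRec (a : Bond (F.P K).d (fun _ => (F.P K).sitesPerDir 0)) (v w : WRec N) : ⟪RRec F N U₀ a v, RRec F N U₀ a w⟫_ℂ = ⟪v, w⟫_ℂ := by
  rw [RRec_eq_AdW]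
  exact inner_AdW_suToUnits N _ v w

omit k in
/-- `‖R(U₀(a))v‖ = ‖v‖`. [cite: Balaban1985BackgroundPropagators, (3.31) p.395] -/
theorem norm_RRec (a : Bond (F.P K).d (fun _ => (F.P K).sitesPerDir 0)) (v : WRec N) : ‖RRec F N U₀ a v‖ = ‖v‖ := by
  rw [@norm_eq_sqrt_re_inner ℂ, @norm_eq_sqrt_re_inner ℂ, inner_RRec_RRec]

/-- **`D_{U₀}λ = 0` BONDWISE**: `R(U₀(a))λ(a₊) = λ(a₋)` at every bond (`η_k⁻¹ ≠ 0`). [cite: Balaban1985BackgroundPropagators, (3.3) p.391] -/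
theorem covDerivL2K_apply_eq_zero_iff [Fact (0 < c0Rec F K k)] (l : SiteL2K ℂ (F.P K).d (fun _ => (F.P K).sitesPerDir 0) (c0Rec F K k) (WRec N)) :
    covDerivL2K ℂ (c0Rec F K k) (cRec F K k) (RRec F N U₀) l = 0 ↔
      ∀ a : Bond (F.P K).d (fun _ => (F.P K).sitesPerDir 0),
        RRec F N U₀ a (WL2.equiv ℂ _ _ l (btgt a)) = WL2.equiv ℂ _ _ l (bpos a) := by
  have hc : cRec F K k ≠ 0 := by
    rw [cRec]
    exact inv_ne_zero (Complex.ofReal_ne_zero.2 (pow_pos (inv_pos.mpr (Nat.cast_pos.mpr (F.P K).L_pos)) k).ne')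
  constructor
  · intro h a
    have ha := congr_fun (congrArg (WL2.equiv ℂ _ _) h) a
    rw [equiv_covDerivL2K, covDeriv_apply, WL2.equiv_zero, Pi.zero_apply, smul_eq_zero] at ha
    exact sub_eq_zero.1 (ha.resolve_left hc)
  · intro h
    apply (WL2.equiv ℂ (fun _ : Bond (F.P K).d (fun _ => (F.P K).sitesPerDir 0) => c0Rec F K k) (WRec N)).injective
    funext a
    rw [equiv_covDerivL2K, covDeriv_apply, h a, sub_self, smul_zero, WL2.equiv_zero, Pi.zero_apply]

/-! ## §2  A covariantly constant site function has constant fibre norm, hence vanishes if it vanishes somewhere (e.g. at a `k`-block centre) -/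

/-- ★★ **CONSTANT FIBRE NORM**: `D_{U₀}λ = 0` ⟹ `‖λ(z)‖ = ‖λ(0)‖` for every site `z` (the transporters are isometries; the torus is connected by unit steps —
`TorusChart.d₀_eq_zero_iff` on the real function `z ↦ ‖λ(z)‖`). [cite: Balaban1984PropagatorsI, p.22; Balaban1985BackgroundPropagators, (3.3) p.391] -/
theorem norm_apply_const_of_covDerivL2K_eq_zero [Fact (0 < c0Rec F K k)] {l : SiteL2K ℂ (F.P K).d (fun _ => (F.P K).sitesPerDir 0) (c0Rec F K k) (WRec N)}
    (h : covDerivL2K ℂ (c0Rec F K k) (cRec F K k) (RRec F N U₀) l = 0) (z : TSite (F.P K).d (fun _ => (F.P K).sitesPerDir 0)) :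
    ‖WL2.equiv ℂ _ _ l z‖ = ‖WL2.equiv ℂ _ _ l 0‖ := by
  have hb := (covDerivL2K_apply_eq_zero_iff F N k U₀ l).1 h
  have hd : (chartT (fun _ : Fin (F.P K).d => (F.P K).sitesPerDir 0)).d₀ (fun z => ‖WL2.equiv ℂ _ _ l z‖) = 0 := by
    funext y μ
    rw [TorusChart.d₀_apply, Pi.zero_apply, Pi.zero_apply, ← shift_eq_add_gen, sub_eq_zero]
    have hyμ := hb (y, μ)
    rw [← norm_RRec F N U₀ (y, μ) (WL2.equiv ℂ _ _ l (btgt (y, μ))), hyμ]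
  exact ((chartT (fun _ : Fin (F.P K).d => (F.P K).sitesPerDir 0)).d₀_eq_zero_iff _).1 hd z

/-- ★★ **… HENCE VANISHES IF IT VANISHES AT ONE SITE.** [cite: Balaban1984PropagatorsI, p.22] -/
theorem eq_zero_of_covDerivL2K_eq_zero_of_apply_eq_zero [Fact (0 < c0Rec F K k)] {l : SiteL2K ℂ (F.P K).d (fun _ => (F.P K).sitesPerDir 0) (c0Rec F K k) (WRec N)}
    (h : covDerivL2K ℂ (c0Rec F K k) (cRec F K k) (RRec F N U₀) l = 0) {z₀ : TSite (F.P K).d (fun _ => (F.P K).sitesPerDir 0)}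
    (hz : WL2.equiv ℂ _ _ l z₀ = 0) : l = 0 := by
  have h0 : ‖WL2.equiv ℂ _ _ l 0‖ = 0 := by rw [← norm_apply_const_of_covDerivL2K_eq_zero F N k U₀ h z₀, hz, norm_zero]
  apply (WL2.equiv ℂ (fun _ : TSite (F.P K).d (fun _ => (F.P K).sitesPerDir 0) => c0Rec F K k) (WRec N)).injective
  funext z
  have hz' : ‖WL2.equiv ℂ _ _ l z‖ = 0 := by rw [norm_apply_const_of_covDerivL2K_eq_zero F N k U₀ h z, h0]
  rw [norm_eq_zero.1 hz', WL2.equiv_zero, Pi.zero_apply]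


/-- ★★★ **`D_{U₀}λ = 0 → Q′♭λ = 0 → λ = 0` AT EVERY BACKGROUND**: a covariantly constant gauge parameter vanishing at the `k`-block centres (def-Y's ✓`QflatOfRecord`) vanishes —
the kernel statement behind the positivity of print's scalar operator `Δ′_a` ((3.24)) with the centre-restriction site letter. [cite: Balaban1985BackgroundPropagators, (3.24)–(3.25) p.394; Balaban1984PropagatorsI, p.22] -/
theorem eq_zero_of_covDerivL2K_eq_zero_of_QflatOfRecord_eq_zero [Fact (0 < c0Rec F K k)] {l : SiteL2K ℂ (F.P K).d (fun _ => (F.P K).sitesPerDir 0) (c0Rec F K k) (WRec N)}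
    (h : covDerivL2K ℂ (c0Rec F K k) (cRec F K k) (RRec F N U₀) l = 0) (hl : QflatOfRecord F N k l = 0) : l = 0 := by
  have hy := (QflatOfRecord_eq_zero_iff F N k l).1 hl (0 : Site (F.P K) k)
  rw [siteFieldIn_apply, LinearEquiv.map_eq_zero_iff] at hy
  exact eq_zero_of_covDerivL2K_eq_zero_of_apply_eq_zero F N k U₀ h hy

/-! ## §3  `hpos′` at every background: `Δ_{U₀} + Π` is positive definite for every centre-pinning `Π ≥ 0` -/

/-- `re⟪λ, Δ_{U₀}λ⟫ = ‖D_{U₀}λ‖²` for the record's scalar Laplacian ([B9] (3.23), `Δ_{U₀} = D*_{U₀}D_{U₀}`; `conj η_k⁻¹ = η_k⁻¹`, mutually adjoint transporters ✓`inner_RRec_left`).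
[cite: Balaban1985BackgroundPropagators, (3.23) p.394, (3.10) p.392] -/
theorem re_inner_covLaplaceSiteOfRecord [Fact (0 < c0Rec F K k)] (l : SiteL2K ℂ (F.P K).d (fun _ => (F.P K).sitesPerDir 0) (c0Rec F K k) (WRec N)) :
    RCLike.re ⟪l, covLaplaceSiteK (cRec F K k) (RRec F N U₀) (SRec F N U₀) l⟫_ℂ = ‖covDerivL2K ℂ (c0Rec F K k) (cRec F K k) (RRec F N U₀) l‖ ^ 2 := by
  rw [covLaplaceSiteK, LinearMap.comp_apply, inner_covDivL2K_covDerivL2K (cRec F K k) (conj_cRec F K k) _ _ (inner_RRec_left U₀)]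
  norm_cast

/-- ★★★ **`hpos′` AT EVERY BACKGROUND**: for every `Π` on the gauge parameters with `re⟪λ, Πλ⟫ ≥ 0` whose null directions are `Q′♭`-null (`re⟪λ, Πλ⟫ = 0 → Q′♭λ = 0`), print's scalar
operator `Δ′ := Δ_{U₀} + Π` is POSITIVE DEFINITE: `λ ≠ 0 → 0 < re⟪λ, Δ′λ⟫` — no small-field hypothesis, no guard (the displayed `hpos′` of lit's `greenK`∕`printGreen_gaugeMode` for a
(b)-pin, DISCHARGED qualitatively; the spectral GAP is [B9] Thm 3.11 and is NOT here). [cite: Balaban1985BackgroundPropagators, (3.24)–(3.25) p.394, Thm 3.11 p.416] -/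
theorem covLaplaceSiteOfRecord_add_pos [Fact (0 < c0Rec F K k)]
    (Pn : SiteL2K ℂ (F.P K).d (fun _ => (F.P K).sitesPerDir 0) (c0Rec F K k) (WRec N) →ₗ[ℂ] SiteL2K ℂ (F.P K).d (fun _ => (F.P K).sitesPerDir 0) (c0Rec F K k) (WRec N))
    (hP₀ : ∀ l, 0 ≤ RCLike.re ⟪l, Pn l⟫_ℂ) (hP : ∀ l, RCLike.re ⟪l, Pn l⟫_ℂ = 0 → QflatOfRecord F N k l = 0)
    (l : SiteL2K ℂ (F.P K).d (fun _ => (F.P K).sitesPerDir 0) (c0Rec F K k) (WRec N)) (hl : l ≠ 0) :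
    0 < RCLike.re ⟪l, (covLaplaceSiteK (c₀ := c0Rec F K k) (cRec F K k) (RRec F N U₀) (SRec F N U₀) + Pn) l⟫_ℂ := by
  rw [LinearMap.add_apply, inner_add_right, map_add, re_inner_covLaplaceSiteOfRecord]
  have h1 : 0 ≤ ‖covDerivL2K ℂ (c0Rec F K k) (cRec F K k) (RRec F N U₀) l‖ ^ 2 := sq_nonneg _
  have h2 := hP₀ l
  rcases (add_nonneg h1 h2).lt_or_eq with hlt | heq
  · exact hlt
  · exfalso
    have hD : ‖covDerivL2K ℂ (c0Rec F K k) (cRec F K k) (RRec F N U₀) l‖ ^ 2 = 0 := by linarith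
    have hPl : RCLike.re ⟪l, Pn l⟫_ℂ = 0 := by linarith
    have hD' : covDerivL2K ℂ (c0Rec F K k) (cRec F K k) (RRec F N U₀) l = 0 := norm_eq_zero.1 (pow_eq_zero_iff two_ne_zero |>.1 hD)
    exact hl (eq_zero_of_covDerivL2K_eq_zero_of_QflatOfRecord_eq_zero F N k U₀ hD' (hP l hPl))

section KerProj

variable [Fact (0 < c0Rec F K k)] [hK : (LinearMap.ker (QflatOfRecord F N (K := K) k)).HasOrthogonalProjection]

/-- ★ **ONE CONCRETE CENTRE-PINNING TERM**: `Π := a • proj_{N(Q′♭)ᗮ}` (`a > 0`, the orthogonal projection onto the orthogonal complement of def-Y's `N(Q′♭)` in the record's `L²` of gauge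
parameters; the instance `(ker Q′♭).HasOrthogonalProjection` is `HasOrthogonalProjection.ofCompleteSpace` from `FiniteDimensional.complete ℂ _`) satisfies §3's two hypotheses, so
`Δ_{U₀} + a • proj_{N(Q′♭)ᗮ}` is positive definite at EVERY `U₀`. [cite: Balaban1985BackgroundPropagators, (3.24)–(3.25) p.394] -/
theorem covLaplaceSiteOfRecord_add_kerProj_pos {a : ℝ} (ha : 0 < a) (l : SiteL2K ℂ (F.P K).d (fun _ => (F.P K).sitesPerDir 0) (c0Rec F K k) (WRec N)) (hl : l ≠ 0) :
    0 < RCLike.re ⟪l, (covLaplaceSiteK (c₀ := c0Rec F K k) (cRec F K k) (RRec F N U₀) (SRec F N U₀) +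
      (a : ℂ) • ((LinearMap.ker (QflatOfRecord F N (K := K) k))ᗮ.starProjection : _ →L[ℂ] _).toLinearMap) l⟫_ℂ := by
  have hre : ∀ l : SiteL2K ℂ (F.P K).d (fun _ => (F.P K).sitesPerDir 0) (c0Rec F K k) (WRec N),
      RCLike.re ⟪l, ((a : ℂ) • ((LinearMap.ker (QflatOfRecord F N (K := K) k))ᗮ.starProjection : _ →L[ℂ] _).toLinearMap) l⟫_ℂ =
        a * ‖(LinearMap.ker (QflatOfRecord F N (K := K) k))ᗮ.orthogonalProjectionOnto l‖ ^ 2 := by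
    intro l
    rw [LinearMap.smul_apply, inner_smul_right, ContinuousLinearMap.coe_coe, ← Submodule.inner_starProjection_left_eq_right, RCLike.re_to_complex,
      Complex.re_ofReal_mul, ← RCLike.re_to_complex, Submodule.re_inner_starProjection_eq_normSq]
  refine covLaplaceSiteOfRecord_add_pos F N k U₀ _ (fun l => ?_) (fun l hl0 => ?_) l hl
  · rw [hre]
    positivity
  · rw [hre] at hl0
    have hn : ‖(LinearMap.ker (QflatOfRecord F N (K := K) k))ᗮ.orthogonalProjectionOnto l‖ ^ 2 = 0 := by
      rcases mul_eq_zero.1 hl0 with h | h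
      · exact absurd h ha.ne'
      · exact h
    have hp : (LinearMap.ker (QflatOfRecord F N (K := K) k))ᗮ.starProjection l = 0 := by
      rw [Submodule.starProjection_apply, norm_eq_zero.1 (pow_eq_zero_iff two_ne_zero |>.1 hn), Submodule.coe_zero]
    have hmem : l ∈ (LinearMap.ker (QflatOfRecord F N (K := K) k))ᗮᗮ := (Submodule.starProjection_apply_eq_zero_iff _).1 hp
    rw [Submodule.orthogonal_orthogonal] at hmem
    exact LinearMap.mem_ker.1 hmem

/-- The concrete pinning term kills `N(Q′♭)`: `Q′♭λ = 0 → proj_{N(Q′♭)ᗮ} λ = 0` — so `Δ′ = Δ_{U₀}` on `N(Q′♭)`, the `hT′` of lit's `printGreen_gaugeMode`.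
[cite: Balaban1985BackgroundPropagators, (3.24) p.394] -/
theorem kerProj_apply_eq_zero_of_QflatOfRecord_eq_zero (a : ℂ)
    {l : SiteL2K ℂ (F.P K).d (fun _ => (F.P K).sitesPerDir 0) (c0Rec F K k) (WRec N)} (hl : QflatOfRecord F N k l = 0) :
    (covLaplaceSiteK (c₀ := c0Rec F K k) (cRec F K k) (RRec F N U₀) (SRec F N U₀) +
        a • ((LinearMap.ker (QflatOfRecord F N (K := K) k))ᗮ.starProjection : _ →L[ℂ] _).toLinearMap) l =
      covLaplaceSiteK (cRec F K k) (RRec F N U₀) (SRec F N U₀) l := by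
  have hmem : l ∈ (LinearMap.ker (QflatOfRecord F N (K := K) k))ᗮᗮ := by
    rw [Submodule.orthogonal_orthogonal]
    exact LinearMap.mem_ker.2 hl
  have hp : (LinearMap.ker (QflatOfRecord F N (K := K) k))ᗮ.starProjection l = 0 := (Submodule.starProjection_apply_eq_zero_iff _).2 hmem
  rw [LinearMap.add_apply, LinearMap.smul_apply, ContinuousLinearMap.coe_coe, hp, smul_zero, add_zero]

end KerProj

/-! ## §4  Print's `G′ = (Δ′)⁻¹` and `π = 1 − D G′ R D*` at the record: (g5) and the gauge modes -/

section PrintLetters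

variable [Fact (0 < c0Rec F K k)]
  (T' : SiteL2K ℂ (F.P K).d (fun _ => (F.P K).sitesPerDir 0) (c0Rec F K k) (WRec N) →ₗ[ℂ] SiteL2K ℂ (F.P K).d (fun _ => (F.P K).sitesPerDir 0) (c0Rec F K k) (WRec N))
  (hpos' : ∀ x, x ≠ 0 → 0 < RCLike.re ⟪x, T' x⟫_ℂ)
  (hT' : ∀ l, QflatOfRecord F N k l = 0 → T' l = covLaplaceSiteK (cRec F K k) (RRec F N U₀) (SRec F N U₀) l)

include hT' in
/-- ★★ **(g5) AT THE RECORD**: for ANY `Δ′ = T′` positive definite and equal to `Δ_{U₀}` on `N(Q′♭)` (§3 supplies such `T′` at every background), print's `G′ := (T′)⁻¹` (lit `greenK`)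
returns `λ` on `Δ_{U₀}λ`, `Q′♭λ = 0` — lit ✓`printGreen_gaugeMode` at def-Y's letters. [cite: Balaban1985BackgroundPropagators, (3.24)–(3.25) p.394] -/
theorem printGreen_gaugeMode_ofRecord {l : SiteL2K ℂ (F.P K).d (fun _ => (F.P K).sitesPerDir 0) (c0Rec F K k) (WRec N)} (hl : QflatOfRecord F N k l = 0) :
    greenK T' hpos' (covLaplaceSiteK (cRec F K k) (RRec F N U₀) (SRec F N U₀) l) = l :=
  printGreen_gaugeMode (c := cRec F K k) (R := RRec F N U₀) (S := SRec F N U₀) (Q' := QflatOfRecord F N k) T' hpos' hT' hl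

include hT' in
/-- ★★ **PRINT'S `π_{U₀} = 1 − D_{U₀} G′ R D*_{U₀}` AT THE RECORD KILLS THE `N(Q′♭)` GAUGE MODES** (`R := RrOfRecord F N k U₀ Q′♭`, the (3.21) projection of record): `π(D_{U₀}λ) = 0`
for `Q′♭λ = 0` — at EVERY background. [cite: Balaban1985BackgroundPropagators, (3.119) p.419, (3.21) p.394] -/
theorem printProjectionOfRecord_gaugeMode {l : SiteL2K ℂ (F.P K).d (fun _ => (F.P K).sitesPerDir 0) (c0Rec F K k) (WRec N)} (hl : QflatOfRecord F N k l = 0) :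
    ((LinearMap.id : BondL2K ℂ (F.P K).d (fun _ => (F.P K).sitesPerDir 0) (c0Rec F K k) (WRec N) →ₗ[ℂ] _) -
        covDerivL2K ℂ (c0Rec F K k) (cRec F K k) (RRec F N U₀) ∘ₗ greenK T' hpos' ∘ₗ RrOfRecord F N k U₀ (QflatOfRecord F N k) ∘ₗ
          covDivL2K ℂ (c0Rec F K k) (cRec F K k) (SRec F N U₀))
      (covDerivL2K ℂ (c0Rec F K k) (cRec F K k) (RRec F N U₀) l) = 0 :=
  printProjectionLattice_gaugeMode_greenK (c := cRec F K k) (R := RRec F N U₀) (S := SRec F N U₀) (Q' := QflatOfRecord F N k) T' hpos' hT' hl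

end PrintLetters

/-! ## §5  [B9] (3.124) at every guarded background for a `π`-sandwiched Hessian slot — from (g2) (✓p818947) and (g5) (§4) -/

section Slice

variable [NeZero N] [Fact (0 < c0Rec F K k)] [Fact (∀ c, 0 < wBRec F K k c)]
  (T' : SiteL2K ℂ (F.P K).d (fun _ => (F.P K).sitesPerDir 0) (c0Rec F K k) (WRec N) →ₗ[ℂ] SiteL2K ℂ (F.P K).d (fun _ => (F.P K).sitesPerDir 0) (c0Rec F K k) (WRec N))
  (hpos' : ∀ x, x ≠ 0 → 0 < RCLike.re ⟪x, T' x⟫_ℂ)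
  (hT' : ∀ l, QflatOfRecord F N k l = 0 → T' l = covLaplaceSiteK (cRec F K k) (RRec F N U₀) (SRec F N U₀) l)
  (Δ : BondL2K ℂ (F.P K).d (fun _ => (F.P K).sitesPerDir 0) (c0Rec F K k) (WRec N) →ₗ[ℂ] BondL2K ℂ (F.P K).d (fun _ => (F.P K).sitesPerDir 0) (c0Rec F K k) (WRec N))
  (a : ℝ)
  (hposπ : ∀ x, x ≠ 0 → 0 < RCLike.re ⟪x, laplaceALatticeK (cRec F K k) (RRec F N U₀) (SRec F N U₀)
      (LinearMap.adjoint (((LinearMap.id : BondL2K ℂ (F.P K).d (fun _ => (F.P K).sitesPerDir 0) (c0Rec F K k) (WRec N) →ₗ[ℂ] _) -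
          covDerivL2K ℂ (c0Rec F K k) (cRec F K k) (RRec F N U₀) ∘ₗ greenK T' hpos' ∘ₗ RrOfRecord F N k U₀ (QflatOfRecord F N k) ∘ₗ
            covDivL2K ℂ (c0Rec F K k) (cRec F K k) (SRec F N U₀))) ∘ₗ Δ ∘ₗ
        (((LinearMap.id : BondL2K ℂ (F.P K).d (fun _ => (F.P K).sitesPerDir 0) (c0Rec F K k) (WRec N) →ₗ[ℂ] _) -
          covDerivL2K ℂ (c0Rec F K k) (cRec F K k) (RRec F N U₀) ∘ₗ greenK T' hpos' ∘ₗ RrOfRecord F N k U₀ (QflatOfRecord F N k) ∘ₗ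
            covDivL2K ℂ (c0Rec F K k) (cRec F K k) (SRec F N U₀))))
      (RrOfRecord F N k U₀ (QflatOfRecord F N k)) (QOfRecord F N k U₀) a x⟫_ℂ)
  (hguard : SmallBelow (avOfRecord F N K) k U₀)

include hT' hguard in
/-- ★★★ **[B9] (3.124) `Q G̃₁ D R = 0` AT EVERY GUARDED BACKGROUND** for the Hessian slot `Δ_π := π†Δπ` (ANY `Δ`; `π` = print's projection of §4 with ANY admissible `T′`), `Q := QOfRecord F N k U₀`,
`Q′ := QflatOfRecord F N k`, `R := RrOfRecord F N k U₀ Q′♭`, `G̃₁ := G1LatticeK hposπ`: lit ✓`h124_of_printExtension` with (g5) := §4 and (g2) := ✓p818947 — modulo only the DISPLAYED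
positivity `hposπ` of `Δ_{π,a}` ([B9] Thm 3.11∕3.12). [cite: Balaban1985BackgroundPropagators, (3.124) p.420, (3.119) p.419; Balaban1985Variational, (102) p.293, (111) p.294] -/
theorem Q_G1_covDeriv_Rr_ofRecord_pi (s : SiteL2K ℂ (F.P K).d (fun _ => (F.P K).sitesPerDir 0) (c0Rec F K k) (WRec N)) :
    QOfRecord F N k U₀ (G1LatticeK hposπ (covDerivL2K ℂ (c0Rec F K k) (cRec F K k) (RRec F N U₀) (RrOfRecord F N k U₀ (QflatOfRecord F N k) s))) = 0 :=
  h124_of_printExtension (c := cRec F K k) (R := RRec F N U₀) (S := SRec F N U₀) (Q' := QflatOfRecord F N k) (Q := QOfRecord F N k U₀) Δ (greenK T' hpos') hposπ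
    (fun _ hl => printGreen_gaugeMode_ofRecord F N k U₀ T' hpos' hT' hl)
    (fun l hl => QOfRecord_covDerivL2K_eq_zero_of_QflatOfRecord_eq_zero F k U₀ hguard l hl) s

include hT' hguard in
/-- ★★ **p. 425 `R D* G̃₁ D R = R`** for the same slot, from (g2) and (g5). [cite: Balaban1985BackgroundPropagators, p.425] -/
theorem Rr_covDiv_G1_covDeriv_Rr_ofRecord_pi (s : SiteL2K ℂ (F.P K).d (fun _ => (F.P K).sitesPerDir 0) (c0Rec F K k) (WRec N)) :
    RrOfRecord F N k U₀ (QflatOfRecord F N k) (covDivL2K ℂ (c0Rec F K k) (cRec F K k) (SRec F N U₀)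
        (G1LatticeK hposπ (covDerivL2K ℂ (c0Rec F K k) (cRec F K k) (RRec F N U₀) (RrOfRecord F N k U₀ (QflatOfRecord F N k) s)))) =
      RrOfRecord F N k U₀ (QflatOfRecord F N k) s :=
  hRDR_of_invariantExtension (c := cRec F K k) (R := RRec F N U₀) (S := SRec F N U₀) (Q' := QflatOfRecord F N k) (Q := QOfRecord F N k U₀) _ Δ hposπ
    (fun _ hl => printProjectionOfRecord_gaugeMode F N k U₀ T' hpos' hT' hl)
    (fun l hl => QOfRecord_covDerivL2K_eq_zero_of_QflatOfRecord_eq_zero F k U₀ hguard l hl) s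

include hT' hguard in
/-- ★★ **[B9] (3.124) `R D* G̃₁ Q* = 0`** for the same slot with `Δ` SYMMETRIC (then `π†Δπ` is), from (g2) and (g5) and the record's `conj η_k⁻¹ = η_k⁻¹`, mutually adjoint transporters.
[cite: Balaban1985BackgroundPropagators, (3.124) p.420] -/
theorem Rr_covDiv_G1_adjointQ_ofRecord_pi (hΔ : Δ.IsSymmetric) (y : WL2 ℂ (wBRec F K k) (WRec N)) :
    RrOfRecord F N k U₀ (QflatOfRecord F N k) (covDivL2K ℂ (c0Rec F K k) (cRec F K k) (SRec F N U₀)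
        (G1LatticeK hposπ (LinearMap.adjoint (QOfRecord F N k U₀) y))) = 0 :=
  h124'_of_invariantExtension (c := cRec F K k) (R := RRec F N U₀) (S := SRec F N U₀) (Q' := QflatOfRecord F N k) (Q := QOfRecord F N k U₀) _ Δ hposπ
    (conj_cRec F K k) (inner_RRec_left U₀) hΔ
    (fun _ hl => printProjectionOfRecord_gaugeMode F N k U₀ T' hpos' hT' hl)
    (fun l hl => QOfRecord_covDerivL2K_eq_zero_of_QflatOfRecord_eq_zero F k U₀ hguard l hl) y

end Slice

end Summit.QuantumFields.YangMills.Theorems.N07PrintProjectionOfRecord
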